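import Mathlib
import Summits.CriticalPhenomena.CardyFormulaZ2.Theses.CardyBoundaryCoulombGas
import Literature.Probability.Percolation.Crossings
import Literature.Probability.Percolation.IsoradialSquareLatticeGM

/-!
# Sketch (crux-ideate, ideator 3, round 1) — first lemmas for crux `HalfPlaneMarkDensityLaw`
(stmt-CriticalPhenomena-5661, route CardyBoundaryCoulombGas).

Card `flat-boundary-ratio-lemma`: `RatioFlatness`, `UniformMarkBound`, `HalfPlaneCardyWindow`,
`LocalFromWindow` (the composition shape the crux-plan skeleton must prove).
Card `z-invariant-diagonal-boundary-state`: `DiagBoundaryZInvariance` (track transposition),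
`DiagBoundaryAnisotropyFree` (constant angles), `DiagHalfPlaneCardyWindow`, `DiagToAxis`.
Card `three-arc-factorisation`: `ThreeArcFactorisation`, `fkg_upper` shape `FKGTwoArcBound`.
Nothing here is proved; every declaration is a `Prop` that elaborates over tree declarations.
-/

noncomputable section

open Filter MeasureTheory
open Literature.Probability.Percolation Literature.Probability.LatticeModels
open Literature.Probability.RandomPlanarGeometry

namespace Summit.CriticalPhenomena.CardyFormulaZ2.Cruxes.HalfPlaneMarkDensityLaw.SketchIdeator3

/-! ### The axis-parallel lattice half-plane `ℤ × ℕ` and the mark event -/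

/-- The closed upper half-plane of `ℤ²`. -/
def hp : Set (Site 2) := {v | 0 ≤ v 1}

/-- The boundary arc of sites `(t,0)` with `⌊a n⌋ ≤ t ≤ ⌊b n⌋`. -/
def arc (a b : ℝ) (n : ℕ) : Set (Site 2) := {v | v 1 = 0 ∧ ⌊a * n⌋ ≤ v 0 ∧ v 0 ≤ ⌊b * n⌋}

/-- The mark event at the lattice site `(k,0)`: `(k,0)` is joined inside the half-plane to the arc
`[⌊an⌋,⌊bn⌋]` and no boundary site of `[⌊cn⌋, k)` is (i.e. `k` is the `c`-most contact). For
`k = ⌊x n⌋` this is literally the event of the crux `HalfPlaneMarkDensityLaw`. -/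
def markEvent (a b c : ℝ) (n : ℕ) (k : ℤ) : Set (BondConfig (Site 2)) :=
  openCrossing hp (arc a b n) {![k, 0]} \
    openCrossing hp (arc a b n) {v | v 1 = 0 ∧ ⌊c * n⌋ ≤ v 0 ∧ v 0 < k}

/-- Its probability under critical bond percolation. -/
def markProb (a b c : ℝ) (n : ℕ) (k : ℤ) : ℝ :=
  (bondPercolation (zdGraph 2) half).real (markEvent a b c n k)

/-- The half-plane crossing probability `P[(ab) ↔ (c,x)]` with the fourth mark at the lattice site `k`. -/
def hpCrossProb (a b c : ℝ) (n : ℕ) (k : ℤ) : ℝ :=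
  (bondPercolation (zdGraph 2) half).real
    (openCrossing hp (arc a b n) {v | v 1 = 0 ∧ ⌊c * n⌋ ≤ v 0 ∧ v 0 ≤ k})

/-! ### Card 1 — flat-boundary ratio lemma -/

/-- **RatioFlatness** (first lemma of card `flat-boundary-ratio-lemma`; claimed provable now on `ℤ²`):
the mark probability is asymptotically flat at lattice scale near `x`: translating `ℤ × ℕ` by
`k' - k` along its boundary moves only the far marks, by `≤ δn ≪` their distance to the mark, and
the arm-separation coupling at the mark plus RSW continuity in the marks control the ratio. -/
def RatioFlatness : Prop :=
  ∀ a b c x : ℝ, a < b → b < c → c < x → ∀ ε : ℝ, 0 < ε → ∃ δ : ℝ, 0 < δ ∧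
    ∀ᶠ n : ℕ in atTop, ∀ k k' : ℤ, |(k : ℝ) - x * n| ≤ δ * n → |(k' : ℝ) - x * n| ≤ δ * n →
      |markProb a b c n k - markProb a b c n k'| ≤ ε * markProb a b c n k'

/-- **UniformMarkBound** (support, RSW: the boundary two-arm probability from a boundary site to
distance `≍ n` is `O(1/n)` uniformly in the site). -/
def UniformMarkBound : Prop :=
  ∀ a b c x : ℝ, a < b → b < c → c < x → ∃ C δ : ℝ, 0 < δ ∧
    ∀ᶠ n : ℕ in atTop, ∀ k : ℤ, |(k : ℝ) - x * n| ≤ δ * n → (n : ℝ) * markProb a b c n k ≤ C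

/-- **HalfPlaneCardyWindow** — the transfer target `C⁺` of card 1: Cardy's formula for the lattice
half-plane `ℤ × ℕ` with four boundary marks, differenced in the fourth mark (the window law of the
`c`-most contact). By the exact telescoping `Σ_{k ∈ (⌊xn⌋, ⌊x'n⌋]} markProb = hpCrossProb(⌊x'n⌋) − hpCrossProb(⌊xn⌋)`
it is the integrated form of the crux. -/
def HalfPlaneCardyWindow : Prop :=
  ∀ a b c x x' : ℝ, a < b → b < c → c < x → x < x' →
    Tendsto (fun n : ℕ ↦ hpCrossProb a b c n ⌊x' * n⌋ - hpCrossProb a b c n ⌊x * n⌋) atTop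
      (nhds (cardyFunction (crossRatio ![a, b, c, x']) - cardyFunction (crossRatio ![a, b, c, x])))

/-- **LocalFromWindow** — the composition the crux-plan skeleton must certify (pure measure theory +
`PureProductIntegrates`-type calculus: flatness turns window averages into point values). -/
def LocalFromWindow : Prop :=
  RatioFlatness → UniformMarkBound → HalfPlaneCardyWindow →
    Summit.CriticalPhenomena.CardyFormulaZ2.Theses.CardyBoundaryCoulombGas.HalfPlaneMarkDensityLaw

/-! ### Card 2 — Z-invariance of the diagonal half-plane boundary state -/

/-- The diagonal lattice half-plane `{x + y ≥ 0}` of `ℤ²` (= `{j ≥ 0}` in the Grimmett–Manolescu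
track coordinates `i = x - y`, `j = x + y` of `IsoradialSquareLatticeGM`; its boundary line `j = 0`
is a train-track line). -/
def dhp : Set (Site 2) := {v | 0 ≤ v 0 + v 1}

/-- A boundary-connectivity cylinder event of the diagonal half-plane: for a finite family `F` of
pairs of boundary sites and a sub-family `S`, exactly the pairs in `S` are joined inside `dhp`. -/
def dbdEvent (F S : Finset (Site 2 × Site 2)) : Set (BondConfig (Site 2)) :=
  {ω | ∀ p ∈ F, (ω ∈ openConnIn dhp p.1 p.2 ↔ p ∈ S)}

/-- **DiagBoundaryZInvariance** (first lemma of card `z-invariant-diagonal-boundary-state`; claimed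
provable now from the tree's track exchange): in Grimmett–Manolescu's isoradial square lattice
`G_{α,β}` (measure `prodBernoulli (gmWeight α β)`), transposing two consecutive horizontal track
angles `β_{j₀}, β_{j₀+1}` above the boundary line `j = 0` does not change the law of the boundary
connectivity pattern of the diagonal half-plane (the track exchange `Σ` preserves open connections
between persisting vertices, and boundary vertices persist). -/
def DiagBoundaryZInvariance : Prop :=
  ∀ (α β : ℤ → ℝ) (j₀ : ℤ), 0 ≤ j₀ → (∀ i j, 0 < β j - α i ∧ β j - α i < Real.pi) →
    ∀ F S : Finset (Site 2 × Site 2), (∀ p ∈ F, p.1 0 + p.1 1 = 0 ∧ p.2 0 + p.2 1 = 0) → S ⊆ F →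
      prodBernoulli (gmWeight α β) (dbdEvent F S)
        = prodBernoulli (gmWeight α (β ∘ Equiv.swap j₀ (j₀ + 1))) (dbdEvent F S)

/-- **DiagBoundaryAnisotropyFree** (consequence: transpositions + pushing a track to infinity + RSW
insensitivity): for CONSTANT track angles the boundary law of the diagonal half-plane does not
depend on the rhombus angle `θ` at all — critical anisotropic bond percolation `(p_θ, p_{π-θ})` on
the diagonal half-plane has the same boundary state as the isotropic one, exactly, at every finite
scale (verified to machine precision on diagonal cylinders of circumference 3, 4, 5 this session). -/
def DiagBoundaryAnisotropyFree : Prop :=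
  ∀ θ θ' : ℝ, 0 < θ → θ < Real.pi → 0 < θ' → θ' < Real.pi →
    ∀ F S : Finset (Site 2 × Site 2), (∀ p ∈ F, p.1 0 + p.1 1 = 0 ∧ p.2 0 + p.2 1 = 0) → S ⊆ F →
      prodBernoulli (gmWeight (fun _ ↦ 0) (fun _ ↦ θ)) (dbdEvent F S)
        = prodBernoulli (gmWeight (fun _ ↦ 0) (fun _ ↦ θ')) (dbdEvent F S)

/-- Boundary arc of the diagonal half-plane: sites `(t,-t)` with `⌊a n⌋ ≤ t ≤ ⌊b n⌋`. -/
def darc (a b : ℝ) (n : ℕ) : Set (Site 2) := {v | v 0 + v 1 = 0 ∧ ⌊a * n⌋ ≤ v 0 ∧ v 0 ≤ ⌊b * n⌋}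

/-- **DiagHalfPlaneCardyWindow** — the transfer target of card 2: the window law on the DIAGONAL
half-plane of the isotropic lattice (whose boundary state is the Z-invariant / Razumov–Stroganov one). -/
def DiagHalfPlaneCardyWindow : Prop :=
  ∀ a b c x x' : ℝ, a < b → b < c → c < x → x < x' →
    Tendsto (fun n : ℕ ↦
        (bondPercolation (zdGraph 2) half).real (openCrossing dhp (darc a b n) (darc c x' n))
        - (bondPercolation (zdGraph 2) half).real (openCrossing dhp (darc a b n) (darc c x n)))
      atTop (nhds (cardyFunction (crossRatio ![a, b, c, x']) - cardyFunction (crossRatio ![a, b, c, x])))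

/-- **DiagToAxis** — the return ticket (DKKMO rotation invariance by `π/4`, `dkkmo_rotation_invariance`,
plus RSW truncation of half-planes to tilted boxes): the diagonal window law gives the axis-parallel one. -/
def DiagToAxis : Prop := DiagHalfPlaneCardyWindow → HalfPlaneCardyWindow

/-! ### Card 3 — three-arc factorisation (conjectural identity; FKG gives one side) -/

/-- Point-to-arc connection probability in the half-plane: the boundary site `(k,0)` is joined inside
`ℤ × ℕ` to the arc of sites `(t,0)`, `lo ≤ t ≤ hi`. -/
def ptArc (n : ℕ) (k lo hi : ℤ) : ℝ :=
  (bondPercolation (zdGraph 2) half).real (openCrossing hp {![k, 0]} {v | v 1 = 0 ∧ lo ≤ v 0 ∧ v 0 ≤ hi})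

/-- **ThreeArcFactorisation**: the mark probability is asymptotically a universal constant times the
product of the three point-to-arc probabilities from the mark to `[a,b]`, `[b,c]` and `[a,c]`
(shapes: `Δ^{1/3} ∏ (x-x_i)^{-2/3} = ∏_{I} ((|I|)/((x-·)(x-·)))^{1/3}`; exponents `1 = 1/3+1/3+1/3`). -/
def ThreeArcFactorisation : Prop :=
  ∃ C : ℝ, 0 < C ∧ ∀ a b c x : ℝ, a < b → b < c → c < x →
    Tendsto (fun n : ℕ ↦ markProb a b c n ⌊x * n⌋ /
        (ptArc n ⌊x * n⌋ ⌊a * n⌋ ⌊b * n⌋ * ptArc n ⌊x * n⌋ (⌊b * n⌋ + 1) ⌊c * n⌋ *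
          ptArc n ⌊x * n⌋ ⌊a * n⌋ ⌊c * n⌋)) atTop (nhds C)

/-- **FKGTwoArcBound** (the exact one-sided anchor, Harris–FKG for an increasing and a decreasing
event): the mark event is contained in `{x ↔ [a,b]} ∩ {dual closed arm from x⁻ to (b,c)}`, whence
`markProb ≤ P[x ↔ [a,b]] · P[(c,x) ↮ [a,b] ∪ ... ]`; typed here in the weaker, purely primal form. -/
def FKGTwoArcBound : Prop :=
  ∀ a b c : ℝ, ∀ n : ℕ, ∀ k : ℤ,
    markProb a b c n k ≤ ptArc n k ⌊a * n⌋ ⌊b * n⌋ *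
      (bondPercolation (zdGraph 2) half).real
        (openCrossing hp (arc a b n) {v | v 1 = 0 ∧ ⌊c * n⌋ ≤ v 0 ∧ v 0 < k})ᶜ

end Summit.CriticalPhenomena.CardyFormulaZ2.Cruxes.HalfPlaneMarkDensityLaw.SketchIdeator3

end
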